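import Summits.MatrixMultiplication.MatrixMultiplication.Theses.DefinableSTPPDichotomy
import Summits.MatrixMultiplication.MatrixMultiplication.Theorems.PairwiseCurvedTilingsLC.Negative.PairwiseCurvedTilingsLCShadowCounting

/-!
# `PairwiseCurvedTilingsLC` (crux stmt-MatrixMultiplication-17883), line LonelyTranslates:
lonely translates, the `A − C` packing, and `PorosityShadowBound → ¬ PairwiseCurvedTilingsLC`

This file lands crux-ideate k1's kernel-checked reduction (crux directory
`Cruxes/PairwiseCurvedTilingsLC/LonelyTranslates.lean`, §1–§2, with the hand argument of
`NEGATIVE-lonely-translates.md`) for the lead prover's line LonelyTranslates, as importable tree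
content.  Everything here is elementary and sorry-free.

* §1, the combinatorial core ("lonely translates").  `PatternIJ` is the `i = j` pattern of the
  CKSU STPP clause (it contains the block TPP, `k = i`, and the porosity of the `A − C` packing
  along `B − B`, `k ≠ i`); `PairwiseClause` is the crux's full ≥ 2-equal-labels clause for an
  arbitrary index type.  Under `PatternIJ` every translate `(s' − u) − t + B_i` of a block `B_i`
  through a point `s' − u` of the `A − C` shadow `acShadow I A C = ⋃_k (A_k − C_k)` meets the
  shadow in that single point (`lonely_translate`, `card_translate_inter_acShadow`), the shadow is
  a packing, `|⋃_k (A_k − C_k)| = Σ_k |A_k||C_k|` (`card_acShadow`, `sum_card_mul_card_le`), the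
  clause is rotation invariant (`pairwiseClause_rotate`) and the blocks are TPP
  (`card_mul_card_mul_card_le_of_patternIJ`).
* §2, the definable no-go and the target implication.  `PorosityShadowBound` — for ring formulas
  of fixed complexity there are `C, q₁` such that in every finite field of characteristic `≥ q₁`
  every realised family with pattern `i = j` has `Σ_{x : |B_x| > C} |A_x||C_x| ≤ C·|F|^{m−1}` — is
  the HYPOTHESIS of the reduction; it is NOT assumed from the literature: the line's assembly
  derives it from the étale-open topology of pseudo-finite fields (Johnson–Tran–Walsberg–Ye 2024,
  Thm 7.1: no étale-isolated smooth points over large fields; Walsberg–Ye 2023, Thm C/D: definable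
  sets are étale-open in smooth loci off lower-dimensional pieces) together with the
  Chatzidakis–van den Dries–Macintyre counting, compactness and Schwartz–Zippel, because a lonely
  translate through an interior shadow point would make an infinite `B_x` étale-discrete.
  `notLC_of_shadowBound : PorosityShadowBound → ¬ PairwiseCurvedTilingsLC` is PROVED: at
  `ε := 1/(m+1)` the crux gives `η > 0` and families of mass `≥ |F|^{m+η}` in arbitrarily large
  characteristic, while the shadow bound caps the mass at `(C + (2+C)/3)·|F|^m`
  (`mass_le_of_shadowBound`, obtained from `mass_le_of_bcShadowBound` of
  `PairwiseCurvedTilingsLCShadowCounting.lean` applied to the rotated family `(B, C, A)`).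

Design: the first-order plumbing (`shadowFormula`, `blockFormula`, …) already lives in
`PairwiseCurvedTilingsLCFalseOfDefinableTranslateRecurrenceLC.lean` (k2's recurrence-shaped
variant of the same refutation) and is not repeated — its set-form realisation lemma
`realize_shadowFormula_iff` lands next to it in `ShadowFormulaRealize.lean`; `ringChar_le_card`
and the counting `mass_le_of_bcShadowBound` are imported from
`PairwiseCurvedTilingsLCShadowCounting.lean`.  `PorosityShadowBound` is deliberately an uncited
`Prop` of THIS file (an intermediate statement of the line, proved in the line's assembly from
named facts), not a Literature fact.

References: H. Cohn, R. Kleinberg, B. Szegedy, C. Umans, FOCS 2005 (arXiv:math/0511460) Def. 5.1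
(the STPP clause); J. Blasiak, T. Church, H. Cohn, J. A. Grochow, E. Naslund, W. F. Sawin, C. Umans,
Discrete Analysis 2017:3 §2 (packings); W. Johnson, C.-M. Tran, E. Walsberg, J. Ye, "The étale-open
topology and the stable fields conjecture", JEMS 26 (2024), Thm 7.1; E. Walsberg, J. Ye, "Éz fields",
J. Algebra 614 (2023), Thm C, D.
-/

set_option linter.dupNamespace false  -- `Summit.<S>.<S>.…` is the mandated namespace

namespace Summit.MatrixMultiplication.MatrixMultiplication.Theorems.PairwiseCurvedTilingsLC.Negative

open Finset
open Summit.MatrixMultiplication.MatrixMultiplication.Theses.DefinableSTPPDichotomy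

/-! ## §1 Lonely translates and the `A − C` packing (pattern `i = j`) -/

section Combinatorial

variable {H : Type*} [AddCommGroup H] {ι : Type*}

/-- The `i = j` pattern of the CKSU STPP clause (Cohn–Kleinberg–Szegedy–Umans 2005, Def. 5.1;
it contains the block TPP, `k = i`, and the porosity of the `A − C` packing along `B − B`,
`k ≠ i`). [folklore] -/
def PatternIJ (I : Finset ι) (A B C : ι → Finset H) : Prop :=
  ∀ i ∈ I, ∀ k ∈ I, ∀ s ∈ A k, ∀ s' ∈ A i, ∀ t ∈ B i, ∀ t' ∈ B i, ∀ u ∈ C i, ∀ u' ∈ C k,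
    (s' - s) + (t' - t) + (u' - u) = 0 → i = k ∧ s = s' ∧ t = t' ∧ u = u'

/-- The `A − C` shadow `𝒰 = ⋃_{k ∈ I} (A_k − C_k)`. -/
def acShadow [DecidableEq H] (I : Finset ι) (A C : ι → Finset H) : Finset H :=
  I.biUnion fun k => image₂ (· - ·) (A k) (C k)

/-- The pairwise (≥ 2 equal labels) sub-clause of the CKSU STPP clause — verbatim the hypothesis
clause of the crux `PairwiseCurvedTilingsLC` — for an arbitrary index type. [folklore] -/
def PairwiseClause (I : Finset ι) (A B C : ι → Finset H) : Prop :=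
  ∀ i ∈ I, ∀ j ∈ I, ∀ k ∈ I, (i = j ∨ j = k ∨ k = i) →
    ∀ s ∈ A k, ∀ s' ∈ A i, ∀ t ∈ B i, ∀ t' ∈ B j, ∀ u ∈ C j, ∀ u' ∈ C k,
      (s' - s) + (t' - t) + (u' - u) = 0 → i = j ∧ j = k ∧ s = s' ∧ t = t' ∧ u = u'

/-- The pairwise clause implies the `i = j` pattern. -/
theorem patternIJ_of_pairwise {I : Finset ι} {A B C : ι → Finset H}
    (h : PairwiseClause I A B C) : PatternIJ I A B C := by
  intro i hi k hk s hs s' hs' t ht t' ht' u hu u' hu' h0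
  obtain ⟨-, hik, hss, htt, huu⟩ :=
    h i hi i hi k hk (Or.inl rfl) s hs s' hs' t ht t' ht' u hu u' hu' h0
  exact ⟨hik, hss, htt, huu⟩

/-- **Lonely translates.**  Under the `i = j` pattern: if `s' ∈ A_i`, `u ∈ C_i`, `t, t' ∈ B_i` and
`(s' − u) + (t' − t)` lies in the `A − C` shadow, then `t' = t`.  Equivalently the translate
`(s' − u) − t + B_i` meets `⋃_k (A_k − C_k)` only in `s' − u` (and `t' ↦ (s'−u)+(t'−t)` is
injective), although it has `|B_i|` points. -/
theorem lonely_translate [DecidableEq H] {I : Finset ι} {A B C : ι → Finset H}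
    (h : PatternIJ I A B C) {i : ι} (hi : i ∈ I) {s' u t t' : H} (hs' : s' ∈ A i) (hu : u ∈ C i)
    (ht : t ∈ B i) (ht' : t' ∈ B i) (hmem : (s' - u) + (t' - t) ∈ acShadow I A C) : t' = t := by
  simp only [acShadow, mem_biUnion, mem_image₂] at hmem
  obtain ⟨k, hk, s, hs, u', hu', he⟩ := hmem
  have h0 : (s' - s) + (t' - t) + (u' - u) = 0 := by
    have : (s' - s) + (t' - t) + (u' - u) = ((s' - u) + (t' - t)) - (s - u') := by abel
    rw [this, ← he, sub_self]
  exact ((h i hi k hk s hs s' hs' t ht t' ht' u hu u' hu' h0).2.2.1).symm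

/-- The point `s' − u` itself does lie in the shadow. -/
theorem base_mem_acShadow [DecidableEq H] {I : Finset ι} {A C : ι → Finset H} {i : ι} (hi : i ∈ I)
    {s' u : H} (hs' : s' ∈ A i) (hu : u ∈ C i) : s' - u ∈ acShadow I A C := by
  simp only [acShadow, mem_biUnion, mem_image₂]
  exact ⟨i, hi, s', hs', u, hu, rfl⟩

/-- Counting form: the translate `{(s' − u) + (t' − t) : t' ∈ B_i}` has exactly ONE point in the
shadow. -/
theorem card_translate_inter_acShadow [DecidableEq H] {I : Finset ι} {A B C : ι → Finset H}
    (h : PatternIJ I A B C) {i : ι} (hi : i ∈ I) {s' u t : H} (hs' : s' ∈ A i) (hu : u ∈ C i)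
    (ht : t ∈ B i) :
    ((B i).image fun t' => (s' - u) + (t' - t)).filter (· ∈ acShadow I A C) = {s' - u} := by
  ext v
  simp only [mem_filter, mem_image, mem_singleton]
  constructor
  · rintro ⟨⟨t', ht', rfl⟩, hv⟩
    rw [lonely_translate h hi hs' hu ht ht' hv, sub_self, add_zero]
  · rintro rfl
    exact ⟨⟨t, ht, by rw [sub_self, add_zero]⟩, base_mem_acShadow hi hs' hu⟩

/-- The shadow is a disjoint union and each block embeds: `|𝒰| = Σ_k |A_k||C_k|` (packing, from the
`t = t'` instances of the pattern). -/
theorem card_acShadow [DecidableEq H] {I : Finset ι} {A B C : ι → Finset H}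
    (h : PatternIJ I A B C) (hB : ∀ k ∈ I, (B k).Nonempty) :
    (acShadow I A C).card = ∑ k ∈ I, (A k).card * (C k).card := by
  classical
  rw [acShadow, card_biUnion]
  · refine sum_congr rfl fun k hk => ?_
    rw [card_image₂_iff.2]
    intro ⟨a, c⟩ hac ⟨a', c'⟩ hac' heq
    simp only [Set.mem_prod, mem_coe] at hac hac'
    obtain ⟨t, ht⟩ := hB k hk
    have h0 : (a' - a) + (t - t) + (c - c') = 0 := by
      have : (a' - a) + (t - t) + (c - c') = (a' - c') - (a - c) := by abel
      rw [this]; exact sub_eq_zero.2 heq.symm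
    obtain ⟨-, haa, -, hcc⟩ := h k hk k hk a hac.1 a' hac'.1 t ht t ht c' hac'.2 c hac.2 h0
    exact Prod.ext haa hcc.symm
  · intro k hk l hl hkl
    rw [Function.onFun, disjoint_left]
    intro v hvk hvl
    simp only [mem_image₂] at hvk hvl
    obtain ⟨a, ha, c, hc, rfl⟩ := hvk
    obtain ⟨a', ha', c', hc', he⟩ := hvl
    obtain ⟨t, ht⟩ := hB k hk
    have h0 : (a - a') + (t - t) + (c' - c) = 0 := by
      have : (a - a') + (t - t) + (c' - c) = (a - c) - (a' - c') := by abel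
      rw [this, he, sub_self]
    exact hkl (h k hk l hl a' ha' a ha t ht t ht c hc c' hc' h0).1

end Combinatorial

section Packing

variable {H : Type*} [AddCommGroup H] {ι : Type*}

/-- The pairwise clause is invariant under the rotation `(A, B, C) ↦ (B, C, A)`. -/
theorem pairwiseClause_rotate {I : Finset ι} {A B C : ι → Finset H} (h : PairwiseClause I A B C) :
    PairwiseClause I B C A := by
  intro i hi j hj k hk hijk s hs s' hs' t ht t' ht' u hu u' hu' h0
  -- the clause with `(i₀, j₀, k₀) := (k, i, j)`, `s₀ := u, s₀' := u', t₀ := s, t₀' := s', u₀ := t,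
  -- u₀' := t'`
  have h0' : (u' - u) + (s' - s) + (t' - t) = 0 := by rw [← h0]; abel
  have hor : (k = i ∨ i = j ∨ j = k) := by tauto
  obtain ⟨hki, hij, huu, hss, htt⟩ := h k hk i hi j hj hor u hu u' hu' s hs s' hs' t ht t' ht' h0'
  exact ⟨hij, hij.symm.trans hki.symm, hss, htt, huu⟩

/-- Restriction of the clause to a sub-index-set. -/
theorem pairwiseClause_mono {I J : Finset ι} {A B C : ι → Finset H} (hJI : J ⊆ I)
    (h : PairwiseClause I A B C) : PairwiseClause J A B C :=
  fun i hi j hj k hk => h i (hJI hi) j (hJI hj) k (hJI hk)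

/-- `A − C` packing: `Σ_k |A_k||C_k| ≤ |H|` (all `B_k ≠ ∅`). -/
theorem sum_card_mul_card_le [Fintype H] [DecidableEq H] {I : Finset ι} {A B C : ι → Finset H}
    (h : PatternIJ I A B C) (hB : ∀ k ∈ I, (B k).Nonempty) :
    ∑ k ∈ I, (A k).card * (C k).card ≤ Fintype.card H := by
  rw [← card_acShadow h hB]; exact card_le_univ _

/-- Block TPP from the `i = j` pattern alone: `|A_i||B_i||C_i| ≤ |H|` (the sum map is injective on
`A_i × B_i × C_i`).  (The same bound from the full pairwise clause is `card_mul_card_mul_card_le`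
of `UniformEta.lean`.) -/
theorem card_mul_card_mul_card_le_of_patternIJ [Fintype H] {I : Finset ι} {A B C : ι → Finset H}
    (h : PatternIJ I A B C) {i : ι} (hi : i ∈ I) :
    (A i).card * (B i).card * (C i).card ≤ Fintype.card H := by
  classical
  have hinj : Set.InjOn (fun p : H × H × H => p.1 + (p.2.1 + p.2.2))
      ((A i) ×ˢ ((B i) ×ˢ (C i)) : Finset (H × H × H)) := by
    rintro ⟨a₁, b₁, c₁⟩ h₁ ⟨a₂, b₂, c₂⟩ h₂ heq
    simp only [coe_product, Set.mem_prod, mem_coe] at h₁ h₂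
    have h0 : (a₁ - a₂) + (b₁ - b₂) + (c₁ - c₂) = 0 := by
      have : (a₁ - a₂) + (b₁ - b₂) + (c₁ - c₂) = (a₁ + (b₁ + c₁)) - (a₂ + (b₂ + c₂)) := by abel
      rw [this]; exact sub_eq_zero.2 heq
    obtain ⟨-, ha, hb, hc⟩ :=
      h i hi i hi a₂ h₂.1 a₁ h₁.1 b₂ h₂.2.1 b₁ h₁.2.1 c₂ h₂.2.2 c₁ h₁.2.2 h0
    rw [ha, hb, hc]
  have := card_le_card_of_injOn _ (fun p _ => mem_univ _) hinj
  simpa [card_product, card_univ, mul_assoc] using this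

end Packing

/-! ## §2 The definable no-go (hypothesis of the reduction) and the target implication (PROVED) -/

/-- **Definable porosity shadow bound** (the hypothesis of the reduction; the line's assembly
derives it from the étale-open topology of pseudo-finite fields — no étale-isolated smooth points,
definable sets étale-open in smooth loci — plus compactness, transfer and Schwartz–Zippel): for
ring formulas of fixed complexity there are `C, q₁` such that in every finite field of
characteristic `≥ q₁` every realised family satisfying the `i = j` pattern has
`Σ_{x : |B_x| > C} |A_x||C_x| ≤ C·|F|^{m−1}` — the blocks whose `B`-set is large have an `A − C`
shadow of LOWER dimension.  (Real exponent `m − 1`; for `m = 0` the sum is empty.) -/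
def PorosityShadowBound : Prop :=
  ∀ (e m k : ℕ) (φI : FirstOrder.Language.ring.Formula (Fin e ⊕ Fin k))
    (φA φB φC : FirstOrder.Language.ring.Formula ((Fin e ⊕ Fin m) ⊕ Fin k)),
    ∃ C q₁ : ℕ, ∀ (F : Type) [Field F] [Fintype F] [FirstOrder.Ring.CompatibleRing F],
      q₁ ≤ ringChar F →
      ∀ (y : Fin k → F) (I : Finset (Fin e → F)) (A B C' : (Fin e → F) → Finset (Fin m → F)),
        (∀ x, x ∈ I ↔ φI.Realize (Sum.elim x y)) →
        (∀ x v, v ∈ A x ↔ φA.Realize (Sum.elim (Sum.elim x v) y)) →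
        (∀ x v, v ∈ B x ↔ φB.Realize (Sum.elim (Sum.elim x v) y)) →
        (∀ x v, v ∈ C' x ↔ φC.Realize (Sum.elim (Sum.elim x v) y)) →
        PatternIJ I A B C' →
        ((∑ x ∈ I.filter (fun x => C < (B x).card), (A x).card * (C' x).card : ℕ) : ℝ)
          ≤ C * (Fintype.card F : ℝ) ^ ((m : ℝ) - 1)

/-- Target implication of the line: the shadow bound refutes the crux. -/
def NotLCOfShadowBound : Prop := PorosityShadowBound → ¬ PairwiseCurvedTilingsLC

section MassBound

variable {H : Type*} [AddCommGroup H] [Fintype H] {ι : Type*}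

/-- **Mass bound from an `A − C` shadow bound on the big-`B` blocks.**  For a family satisfying
the pairwise clause in a finite abelian group of order `q^m` (`q ≥ 1`), if the blocks with
`|B| > C` have `Σ |A||C| ≤ C q^{m−1}`, then for every `0 < ε ≤ 1` with `mε ≤ 1` the mass at
exponent `(2+ε)/3` is at most `(C + (2+C)/3)·q^m`.  (This is `mass_le_of_bcShadowBound` for the
rotated family `(B, C, A)`, whose `B − C` shadow is the `A − C` shadow of `(A, B, C)`.) -/
theorem mass_le_of_shadowBound (I : Finset ι) (A B C : ι → Finset H)
    (h : PairwiseClause I A B C) (Cb : ℕ) {q : ℝ} (hq : 1 ≤ q) (m : ℕ)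
    (hH : (Fintype.card H : ℝ) = q ^ (m : ℝ))
    (hshadow : ∑ x ∈ I.filter (fun x => Cb < (B x).card), ((A x).card : ℝ) * (C x).card
      ≤ Cb * q ^ ((m : ℝ) - 1))
    {ε : ℝ} (hε : 0 < ε) (hε1 : ε ≤ 1) (hmε : (m : ℝ) * ε ≤ 1) :
    ∑ x ∈ I, (((A x).card * (B x).card * (C x).card : ℕ) : ℝ) ^ ((2 + ε) / 3)
      ≤ ((Cb : ℝ) + (2 + Cb) / 3) * q ^ (m : ℝ) := by
  have hshadow' : ∑ x ∈ I.filter (fun x => Cb < (B x).card), ((C x).card : ℝ) * (A x).card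
      ≤ Cb * q ^ ((m : ℝ) - 1) := by
    calc ∑ x ∈ I.filter (fun x => Cb < (B x).card), ((C x).card : ℝ) * (A x).card
        = ∑ x ∈ I.filter (fun x => Cb < (B x).card), ((A x).card : ℝ) * (C x).card :=
          sum_congr rfl fun x _ => mul_comm _ _
      _ ≤ Cb * q ^ ((m : ℝ) - 1) := hshadow
  have hmain := mass_le_of_bcShadowBound (pairwiseClause_rotate h) Cb hq m hH hshadow' hε hε1 hmε
  calc ∑ x ∈ I, (((A x).card * (B x).card * (C x).card : ℕ) : ℝ) ^ ((2 + ε) / 3)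
      = ∑ x ∈ I, (((B x).card * (C x).card * (A x).card : ℕ) : ℝ) ^ ((2 + ε) / 3) :=
        sum_congr rfl fun x _ => by congr 2; ring
    _ ≤ ((Cb : ℝ) + (2 + Cb) / 3) * q ^ (m : ℝ) := hmain

end MassBound

/-- **The shadow bound refutes the crux** (PROVED): given `PorosityShadowBound`,
`PairwiseCurvedTilingsLC` is false.  Take `ε := 1/(m+1)`; the crux supplies `η > 0` and fields of
arbitrarily large characteristic carrying families of mass `≥ |F|^{m+η}`; the shadow bound and
`mass_le_of_shadowBound` cap the mass at `K·|F|^m`, `K = C + (2+C)/3`; absurd once `|F|^η > K`. -/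
theorem notLC_of_shadowBound : NotLCOfShadowBound := by
  intro hPSB hLC
  classical
  obtain ⟨e, m, k, φI, φA, φB, φC, hfam⟩ := hLC
  obtain ⟨Cb, q₁, hbd⟩ := hPSB e m k φI φA φB φC
  set ε : ℝ := 1 / ((m : ℝ) + 1) with hεdef
  have hm0 : (0 : ℝ) ≤ m := Nat.cast_nonneg m
  have hε : 0 < ε := by rw [hεdef]; positivity
  have hε1 : ε ≤ 1 := by
    rw [hεdef, div_le_one (by linarith)]; linarith
  have hmε : (m : ℝ) * ε ≤ 1 := by
    rw [hεdef, mul_one_div, div_le_one (by linarith)]; linarith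
  obtain ⟨η, hη, hall⟩ := hfam ε hε
  set K : ℝ := (Cb : ℝ) + (2 + Cb) / 3 with hK
  have hK0 : 0 < K := by rw [hK]; positivity
  -- a threshold beyond which `q^η > K`
  set N : ℕ := Nat.ceil ((K + 1) ^ (1 / η)) with hN
  obtain ⟨F, instF, instFin, instCR, hchar, y, I, A, B, C', hI, hA, hB, hC, hpair, hmass⟩ :=
    hall (max q₁ (max N 2))
  have hcardF : max q₁ (max N 2) ≤ Fintype.card F := hchar.trans (ringChar_le_card F)
  set q : ℝ := (Fintype.card F : ℝ) with hqdef
  have hq2 : (2 : ℝ) ≤ q := by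
    rw [hqdef]; exact_mod_cast le_trans (le_max_right _ _) (le_trans (le_max_right _ _) hcardF)
  have hq1 : (1 : ℝ) ≤ q := by linarith
  have hq0 : (0 : ℝ) < q := by linarith
  have hKq : K < q ^ η := by
    have h1 : (K + 1) ^ (1 / η) ≤ q := by
      have : (N : ℝ) ≤ q := by
        rw [hqdef]; exact_mod_cast le_trans (le_max_left _ _) (le_trans (le_max_right _ _) hcardF)
      exact le_trans (Nat.le_ceil _) this
    have h2 : K + 1 ≤ q ^ η := by
      calc K + 1 = ((K + 1) ^ (1 / η)) ^ η := by
            rw [← Real.rpow_mul (by positivity), one_div, inv_mul_cancel₀ hη.ne', Real.rpow_one]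
        _ ≤ q ^ η := Real.rpow_le_rpow (by positivity) h1 hη.le
    linarith
  -- the shadow bound for this family
  have hshadow := hbd F (le_trans (le_max_left _ _) hchar) y I A B C' hI hA hB hC
    (patternIJ_of_pairwise hpair)
  -- the mass bound
  have hH : (Fintype.card (Fin m → F) : ℝ) = q ^ (m : ℝ) := by
    rw [Real.rpow_natCast, Fintype.card_fun, Fintype.card_fin]; push_cast; rfl
  have hshadow' : ∑ x ∈ I.filter (fun x => Cb < (B x).card), ((A x).card : ℝ) * (C' x).card
      ≤ Cb * q ^ ((m : ℝ) - 1) := by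
    have := hshadow; push_cast at this; exact this
  have hmassle := mass_le_of_shadowBound I A B C' hpair Cb hq1 m hH hshadow' hε hε1 hmε
  -- contradiction: `q^{m+η} ≤ mass ≤ K q^m < q^η q^m = q^{m+η}`
  have hlt : K * q ^ (m : ℝ) < q ^ ((m : ℝ) + η) := by
    rw [Real.rpow_add hq0, mul_comm]
    exact mul_lt_mul_of_pos_left hKq (Real.rpow_pos_of_pos hq0 _)
  exact absurd (hmass.trans hmassle) (not_le.2 hlt)

end Summit.MatrixMultiplication.MatrixMultiplication.Theorems.PairwiseCurvedTilingsLC.Negative
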